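import Literature.MathematicalPhysics.QuantumFieldTheory.Balaban1983to89.B16Ineq111Gaussian
import Literature.MathematicalPhysics.QuantumFieldTheory.Balaban1983to89.B16Eq18Proof

/-!
# `Balaban1983to89.B16Ineq19BoxChart` — T. Bałaban, *Large field renormalization. II. Localization, exponentiation,
and bounds for the 𝐑 operation*, Commun. Math. Phys. **122** (1989) 355–392 [Balaban1989LargeFieldII], Sect. 1
p. 358: (1.9) *"The inequalities (1.7), (1.8) imply finally ⟨H_{1,k}B′, Δ₁(ζ₀)H_{1,k}B′⟩ ≧ γ₀/(2d(100M)⁵)‖B′‖², (1.9)"*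
ON THE BOX CHART of the `B′`-integral (1.2) — the chart variables are the real components of `B′(b)` on the bonds
`b ∈ Λ` off the comb tree `G₀` of the rectangular parallelepiped `Λ = box n y` (the gauge `δ_{G₀}` solved), and
on that chart (1.8) is the PROVED theorem `B16Eq18Proof.ineq18_box_vec` (Phase-2 seat p30 / r13 gen 2); so the (1.9)
input `Q_lower` of the chart model `B16Ineq111Gaussian.Inputs` (behind the PROVED rows B16.Lem@358 / B16.Eq1.11,
r13 gen 6) follows from the (1.7) hypothesis alone (kind «implication / knitting», Phase 2 of the mega-formalization
`lit-balaban`, reader/typer block r13 gen 6; HOME `run/shared/lean/pub/lit-balaban/`, rows `lit-balaban-r13/ROWS-B16.md`,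
SKELETON rows **B16.Eq1.9**, B16.Eq1.8, B16.Eq1.7).

statement-level skeleton of published theorems with citation tags; proofs where landed; nothing here is a claim about
the Yang–Mills mass gap

PDF held: `paper:balaban1989-cmp122-large-field-ii` (journal page = PDF page + 354); p. 358 [PDF 4] (render
`run/shared/lean/pub/pub-balaban/b2b-balaban-ref1/pages/1989-cmp122-large-field-II/…-p004-x2.png`, read as an image by
r13 gen 1; OCR `p0004.txt` re-read by gen 6).

WHAT IS HERE.  `chartSet n y D` = the index set `(Λ-bonds ∖ G₀) × Fin D` of the chart (`D = dim 𝔤`); `ext x` = the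
𝔤-valued bond function of a chart point `x` (zero on `G₀` and outside `Λ`: `ext_eq_zero_of_mem_treeBonds`);
`sum_sq_ext_eq_sqN` (`Σ_{b∈Λ}|B′(b)|² = ‖x‖²` = `B16Ineq111Gaussian.sqN x`); `ineq18_ext` ((1.8) for `ext x`, from
`B16Eq18Proof.ineq18_box_vec`); **`ineq19_chart_of_17`** — (1.9) `B16Sect1Wilson.Ineq19 (Q x) (sqN x) γ₀ d M` at every
chart point from the (1.7) hypothesis `B16Sect1Wilson.Ineq17 (Q x) ‖∂(ext x)‖² (sqN x) γ₀ C M R_k ε_k` and the printed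
smallness *"for g_k sufficiently small"* (`B16Sect1Wilson.ineq19_of_17_18`); i.e. the hypothesis `h19` of
`B16Ineq111Gaussian.Inputs.ofPrinted` is DISCHARGED on the box chart modulo (1.7).  Mathlib + the two imported files;
no `sorry`, no new `def … : Prop`.
-/

namespace Literature.MathematicalPhysics.QuantumFieldTheory.Balaban1983to89.B16Ineq19BoxChart

open Literature.MathematicalPhysics.QuantumFieldTheory.Balaban1983to89
open Finset B16Eq18Proof B16Ineq111Gaussian B16Sect1Wilson

noncomputable section

variable {d : ℕ} {n : Fin d → ℕ} {y : Fin d → ℤ} {D : ℕ}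

/-- The index set of the box chart: pairs (bond of `Λ` off the comb tree `G₀`, Lie-algebra component) — the free real
integration variables of `∫dB′↾_Λ δ_{G₀}(B′) …` in (1.2). [cite: Balaban1989LargeFieldII, (1.2) p.357] -/
def chartSet (n : Fin d → ℕ) (y : Fin d → ℤ) (D : ℕ) : Finset (((Fin d → ℤ) × Fin d) × Fin D) :=
  (innerBonds n y \ treeBonds n y) ×ˢ (univ : Finset (Fin D))

/-- Membership in the chart index set. [cite: Balaban1989LargeFieldII, (1.2) p.357] -/
theorem mem_chartSet {i : ((Fin d → ℤ) × Fin d) × Fin D} :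
    i ∈ chartSet n y D ↔ i.1 ∈ innerBonds n y ∧ i.1 ∉ treeBonds n y := by
  simp only [chartSet, mem_product, mem_sdiff, mem_univ, and_true]

/-- The 𝔤-valued bond function `B′` of a chart point `x`: the coordinate `x(b, a)` on the free bonds, `0` on the tree
`G₀` and outside `Λ`. [cite: Balaban1989LargeFieldII, (1.2) p.357] -/
def ext (x : chartSet n y D → ℝ) (b : (Fin d → ℤ) × Fin d) (a : Fin D) : ℝ :=
  if h : (b, a) ∈ chartSet n y D then x ⟨(b, a), h⟩ else 0

/-- `B′ = 0` on the bonds of `G₀` (the gauge condition `δ_{G₀}(B′)`). [cite: Balaban1989LargeFieldII, (1.8) p.358] -/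
theorem ext_eq_zero_of_mem_treeBonds (x : chartSet n y D → ℝ) {b : (Fin d → ℤ) × Fin d}
    (hb : b ∈ treeBonds n y) : ext x b = 0 := by
  funext a
  unfold ext
  rw [dif_neg]
  · rfl
  · intro h
    exact (mem_chartSet.mp h).2 hb

/-- `Σ_{b∈Λ} |B′(b)|² = ‖x‖²`: the bond sum of (1.8) over `Λ` of the extension is the Euclidean square norm of the chart
point (`B16Ineq111Gaussian.sqN`). [cite: Balaban1989LargeFieldII, (1.8) p.358] -/
theorem sum_sq_ext_eq_sqN (x : chartSet n y D → ℝ) :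
    ∑ b ∈ innerBonds n y, ∑ a, (ext x b a) ^ 2 = sqN x := by
  unfold sqN
  -- rewrite the double sum as a sum over `innerBonds ×ˢ univ`, split off the chart set, where it is `x²`, from the
  -- tree part, where it vanishes
  rw [← Finset.sum_product (s := innerBonds n y) (t := (univ : Finset (Fin D))) (f := fun i => (ext x i.1 i.2) ^ 2)]
  have hsub : chartSet n y D ⊆ innerBonds n y ×ˢ (univ : Finset (Fin D)) := by
    intro i hi
    rw [mem_product]
    exact ⟨(mem_chartSet.mp hi).1, mem_univ _⟩
  rw [← Finset.sum_sdiff hsub]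
  have hzero : ∑ i ∈ innerBonds n y ×ˢ univ \ chartSet n y D, (ext x i.1 i.2) ^ 2 = 0 := by
    refine Finset.sum_eq_zero fun i hi => ?_
    have hi' : (i.1, i.2) ∉ chartSet n y D := by simpa using (mem_sdiff.mp hi).2
    simp [ext, dif_neg hi']
  rw [hzero, zero_add, ← Finset.sum_coe_sort]
  refine Finset.sum_congr rfl fun i _ => ?_
  have hi : ((i : ((Fin d → ℤ) × Fin d) × Fin D).1, (i : ((Fin d → ℤ) × Fin d) × Fin D).2) ∈ chartSet n y D := by
    exact i.2
  simp only [ext, dif_pos hi]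

/-- **(1.8) on the box chart** — `Ineq18 ‖x‖² ‖∂(ext x)‖² d M` for every chart point, from the PROVED
`B16Eq18Proof.ineq18_box_vec` (sides `n_i ≤ 100M`). [cite: Balaban1989LargeFieldII, (1.8) p.358] -/
theorem ineq18_ext (M : ℕ) (hM : 1 ≤ M) (hn : ∀ i, n i ≤ 100 * M) (x : chartSet n y D → ℝ) :
    Ineq18 (sqN x) (∑ p ∈ innerPlaq n y, ∑ a, B6TreeGaugePoincare.curl (fun b => ext x b a) p.1 p.2.1 p.2.2 ^ 2) d M := by
  rw [← sum_sq_ext_eq_sqN]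
  exact ineq18_box_vec M hM hn y (ext x) fun b hb => ext_eq_zero_of_mem_treeBonds x hb

/-- **(1.9) on the box chart from (1.7) alone.**  If the quadratic form `Q = ⟨H_{1,k}B′, Δ₁(ζ₀)H_{1,k}B′⟩`, as a function
of the chart point, satisfies (1.7) `B16Sect1Wilson.Ineq17` with `‖∂B′‖²` = the plaquette sum of `∂(ext x)` over `Λ` and
`‖B′‖² = ‖x‖²`, and *"g_k sufficiently small"* (`O(1)(M⁶R_kε_k + e^{−R_k}) ≤ γ₀/(2d(100M)^{d+1})`), then (1.9)
`B16Sect1Wilson.Ineq19 (Q x) ‖x‖² γ₀ d M` at every chart point — the input `h19` of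
`B16Ineq111Gaussian.Inputs.ofPrinted`. [cite: Balaban1989LargeFieldII, (1.9) p.358] -/
theorem ineq19_chart_of_17 {M : ℕ} (hM : 1 ≤ M) (hn : ∀ i, n i ≤ 100 * M) (hd : 1 ≤ d) {γ₀ C Rk εk : ℝ}
    (hγ : 0 ≤ γ₀) (Q : (chartSet n y D → ℝ) → ℝ)
    (h17 : ∀ x, Ineq17 (Q x) (∑ p ∈ innerPlaq n y, ∑ a, B6TreeGaugePoincare.curl (fun b => ext x b a) p.1 p.2.1 p.2.2 ^ 2)
      (sqN x) γ₀ C M Rk εk)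
    (hsmall : C * ((M : ℝ) ^ 6 * Rk * εk + Real.exp (-Rk)) ≤ γ₀ / (2 * d * (100 * (M : ℝ)) ^ (d + 1))) :
    ∀ x, Ineq19 (Q x) (sqN x) γ₀ d (M : ℝ) := fun x =>
  ineq19_of_17_18 hd (by exact_mod_cast hM) hγ (sqN_nonneg x) (h17 x) (ineq18_ext M hM hn x) hsmall

end

end Literature.MathematicalPhysics.QuantumFieldTheory.Balaban1983to89.B16Ineq19BoxChart
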